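import Summits.BirchSwinnertonDyer.BirchSwinnertonDyer.Theses.ResidualThetaTransportAtTwo
import Summits.BirchSwinnertonDyer.BirchSwinnertonDyer.Theorems.ResidualThetaTransportAtTwoSignedMuVanishingAtTwoPlusAnalyticAtW
import HarnessLib

/-!
# Route `ResidualThetaTransportAtTwo`, crux Kμ⁺ `SignedMuVanishingAtTwoPlus` (stmt-BirchSwinnertonDyer-20689):
# the line `birth` v4 END TO END — the crux BY NAME from its four registered stub statements, and back

Lead line `birth` v4 (seat bsd-wall-rtt-p4 g2; skeleton `Cruxes/SignedMuVanishingAtTwoPlus/Lines/birth.lean`,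
registered stubs `stub_residualSeedAtTwo` = child 21438 `SignedMuSeedAtTwoPlus` BY NAME, `stub_propagationR` =
item 22891 `SignedMuPropagationAtTwoR` VERBATIM, `stub_periodUnitAtTwo` (PER), `stub_flatMuZeroAtTwo` (FLAT)).
THEOREMS ONLY (no `def`, no named fact, no `sorry`); the stub statements enter as hypotheses — the two algebraic
ones BY NAME (they are route items), the two analytic ones verbatim; nothing about any curve is asserted; BSD is
not proved by this.

* §1 SUFFICIENCY (the skeleton's composition, sorry-free):
  `signedMuVanishingAtTwoPlus_of_seed_of_propagationR_of_periodUnit_of_flatMuZero` — 21438 ∧ 22891 ∧ PER ∧ FLAT ⇒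
  the crux BY NAME; `…_of_abbesUllmo_…` — the same GRANTED the print fact Abbes–Ullmo Thm A
  (`abbesUllmo_not_dvd_maninConstant_of_not_dvd_level`) in place of PER (lead g0's p567665
  `exists_periodUnit_two_of_abbesUllmo`). So the v4 line is CLOSED MODULO {item 21438, item 22891, the AU fact,
  FLAT}.
* §2 NECESSITY, i.e. what the cut costs: the crux implies the seed (`A := W`; width seat w2's landed
  `signedMuSeedAtTwoPlus_of_signedMuVanishingAtTwoPlus`, file `…Sel2`, not restated here) and, granted PER, implies
  FLAT (`flatMuZero_of_crux_of_periodUnit`, lead g0's `flatMuZero_of_signedMuAnalyticAtTwoPlus_of_periodUnit`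
  argument run on the crux itself); hence GRANTED PER (resp. Abbes–Ullmo) the crux is
  EQUIVALENT to «algebraic half ∧ FLAT» (`signedMuVanishingAtTwoPlus_iff_muAlgebraic_and_flatMuZero_of_periodUnit`,
  `…_of_abbesUllmo`). Of the four stubs only `stub_propagationR` asserts more than the crux does (transport for
  EVERY mod-2-congruent good-supersingular pair, not only along the habitat) — the line's one genuine
  strengthening, and its hardest stub.
* §3 CROSS-ROUTE (the seed «shared in substance with ThetaPartnerAtTwo's K2», F-RTT-1 (a)): at a habitat⁺ curve
  `W` that HAS a rational CM partner `A` (good supersingular at 2, `a₂(A) = 0`, `W[2] ≃ A[2]` G_ℚ-equivariantly —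
  the 19-class rational theta habitat), the seed conclusion at `W` follows from route ThetaPartnerAtTwo's K2
  `SignedMainConjectureCMTwo` (item 20307) BY NAME (`seedAt_of_cmPartner_of_signedMainConjectureCMTwo`), and from
  its rank-0 form `SignedMainConjectureCMTwoRankZero` (item 20312) when `A` has analytic rank 0.

References: R. Greenberg, V. Vatsal, Invent. Math. 142 (2000) p. 3, Prop. (2.8) [GreenbergVatsal2000]; B. D. Kim,
Compositio Math. 145 (2009) Cor. 2.13 [BDKim2009]; R. Pollack, Duke Math. J. 118 (2003) Prop. 6.18, Conj. 6.3
[Pollack2003]; R. Pollack, T. Weston, Duke Math. J. 156 (2011) Rem. 4.2 (1) [PollackWeston2011MT]; A. Abbes,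
E. Ullmo, Compositio Math. 103 (1996) Thm. A [AbbesUllmo1996]; R. Pollack, K. Rubin, Ann. of Math. 159 (2004)
Thm. 7.3 [PollackRubin2004].
-/

set_option autoImplicit false
set_option linter.dupNamespace false

noncomputable section

open scoped Classical MatrixGroups ModularForm

open CongruenceSubgroup WeierstrassCurve Literature.NumberTheory.EllipticCurves
  Literature.NumberTheory.EllipticCurves.IwasawaAlgebra Literature.NumberTheory.EllipticCurves.ModularForms
  Literature.NumberTheory.EllipticCurves.Rank1Residual Literature.NumberTheory.EllipticCurves.Kobayashi2003
  Summit.BirchSwinnertonDyer.Rank1Residual.Supersingular Summit.BirchSwinnertonDyer.Rank1Residual.X1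
  Summit.BirchSwinnertonDyer.BirchSwinnertonDyer.Theses.ResidualThetaTransportAtTwo

namespace Summit.BirchSwinnertonDyer.BirchSwinnertonDyer.Theorems.SignedMuAtTwo

/-! ## §1. Sufficiency: the crux BY NAME from the four v4 stub statements -/

/-- **The algebraic half from SEED ∧ PROPAGATION-R** (pure logic; the skeleton's
`muAlgebraicZero_of_seed_of_propagationR`): on the habitat⁺ (`Δ_W < 0`), the seed child 21438 hands a
mod-2-congruent good-supersingular `a₂ = 0` partner `A` with `X⁺_A` torsion and `μ = 0`, and the narrowed
propagation item 22891 transports «torsion ∧ μ = 0» to every finitely generated `+` signed Selmer dual of `W`.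
[cite: GreenbergVatsal2000, p. 3 and Prop. (2.8)] [cite: BDKim2009, Cor. 2.13] -/
theorem muAlgebraic_of_seed_of_propagationR (hSeed : SignedMuSeedAtTwoPlus) (hProp : SignedMuPropagationAtTwoR) :
    ∀ (W : WeierstrassCurve ℚ) [W.IsElliptic] [W.IsGloballyMinimal], ¬ W.HasCM → W.analyticRank = 0 →
      GoodSS W 2 → W.frobeniusTrace 2 = 0 → W.Δ < 0 →
      ∀ (κ : ZpExtension ℚ 2) (γ : Field.absoluteGaloisGroup ℚ), κ.IsCyclotomic → κ.IsTopGenerator γ →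
      ∀ (D : SignedSelmerDualData W κ γ 1) [Module.Finite (IwasawaAlgebra 2) D.X],
        Module.IsTorsion (IwasawaAlgebra 2) D.X ∧ D.mu = 0 := by
  intro W _ _ hCM hr hss ha hΔ κ γ hκ hγ D _
  obtain ⟨A, hAell, hAmin, hssA, haA, hiso, hμA⟩ := hSeed W hCM hr hss ha hΔ
  exact hProp W A hss ha hΔ hssA haA hiso hμA κ γ hκ hγ D

/-- **THE v4 LINE, END TO END**: SEED (child 21438) ∧ PROPAGATION-R (item 22891) ∧ PER (the period unit at 2,
stub `stub_periodUnitAtTwo` verbatim) ∧ FLAT (`2 ∤ L♭` for every Pollack pair at 2 of every habitat⁺ newform, stub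
`stub_flatMuZeroAtTwo` verbatim) ⇒ the crux decl `SignedMuVanishingAtTwoPlus` BY NAME. The analytic half is lead g0's
`mu_eq_of_isPollackPair_two_of_periodUnit_of_not_two_dvd` (p567665). [cite: Pollack2003, Prop. 6.18]
[cite: GreenbergVatsal2000, p. 3 and Prop. (2.8)] -/
theorem signedMuVanishingAtTwoPlus_of_seed_of_propagationR_of_periodUnit_of_flatMuZero
    (hSeed : SignedMuSeedAtTwoPlus) (hProp : SignedMuPropagationAtTwoR)
    (hper : ∀ (W : WeierstrassCurve ℚ) [W.IsElliptic] [W.IsGloballyMinimal], GoodSS W 2 →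
      ∀ [NeZero (W.conductorNorm ℤ)] (f : CuspForm (Gamma0 (W.conductorNorm ℤ)) 2), IsNewformOf W f →
      ∃ u : ℚ, ‖(u : ℚ_[2])‖ = 1 ∧ W.realPeriodRat = u * plusPeriod f)
    (hflat : ∀ (W : WeierstrassCurve ℚ) [W.IsElliptic] [W.IsGloballyMinimal], ¬ W.HasCM →
      W.analyticRank = 0 → GoodSS W 2 → W.frobeniusTrace 2 = 0 → W.Δ < 0 →
      ∀ [NeZero (W.conductorNorm ℤ)] (f : CuspForm (Gamma0 (W.conductorNorm ℤ)) 2), IsNewformOf W f →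
      ∀ (Lplus Lminus : IwasawaAlgebra 2), IsPollackPair f 2 Lplus Lminus →
      ¬ PowerSeries.C (2 : ℤ_[2]) ∣ Lminus) :
    SignedMuVanishingAtTwoPlus := by
  intro W _ _ hCM hr hss ha hΔ
  refine ⟨muAlgebraic_of_seed_of_propagationR hSeed hProp W hCM hr hss ha hΔ, ?_⟩
  intro γ _ _ f hf ϖ hϖ Lplus Lminus hP G m hG
  exact mu_eq_of_isPollackPair_two_of_periodUnit_of_not_two_dvd hϖ (hper W hss f hf)
    (hflat W hCM hr hss ha hΔ f hf Lplus Lminus hP) G m hG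

/-- **The v4 line GRANTED Abbes–Ullmo**: SEED ∧ PROPAGATION-R ∧ the print fact
`abbesUllmo_not_dvd_maninConstant_of_not_dvd_level` (Abbes–Ullmo 1996 Thm A, statement-only in the tree) ∧ FLAT ⇒ the
crux BY NAME — PER is discharged by lead g0's `exists_periodUnit_two_of_abbesUllmo`. So the line is CLOSED MODULO
{21438, 22891, AU, FLAT}. [cite: AbbesUllmo1996, Thm. A] [cite: Pollack2003, Prop. 6.18] -/
theorem signedMuVanishingAtTwoPlus_of_seed_of_propagationR_of_abbesUllmo_of_flatMuZero
    (hSeed : SignedMuSeedAtTwoPlus) (hProp : SignedMuPropagationAtTwoR)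
    (hAU : abbesUllmo_not_dvd_maninConstant_of_not_dvd_level)
    (hflat : ∀ (W : WeierstrassCurve ℚ) [W.IsElliptic] [W.IsGloballyMinimal], ¬ W.HasCM →
      W.analyticRank = 0 → GoodSS W 2 → W.frobeniusTrace 2 = 0 → W.Δ < 0 →
      ∀ [NeZero (W.conductorNorm ℤ)] (f : CuspForm (Gamma0 (W.conductorNorm ℤ)) 2), IsNewformOf W f →
      ∀ (Lplus Lminus : IwasawaAlgebra 2), IsPollackPair f 2 Lplus Lminus →
      ¬ PowerSeries.C (2 : ℤ_[2]) ∣ Lminus) :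
    SignedMuVanishingAtTwoPlus :=
  signedMuVanishingAtTwoPlus_of_seed_of_propagationR_of_periodUnit_of_flatMuZero hSeed hProp
    (fun _ _ _ hss _ _ hf ↦ exists_periodUnit_two_of_abbesUllmo hAU hss hf) hflat

/-! ## §2. Necessity: granted the period unit, the crux ⟺ «algebraic half ∧ FLAT» -/

/-- **Granted PER, the crux implies FLAT**: at a habitat⁺ curve with `Ω_W = u Ω⁺_f`, `|u|₂ = 1`, the period ratio
is `ϖ = u⁻¹ ∈ ℤ₂ˣ`, so `G := C(ϖ)·L♭ ∈ Λ` satisfies `ι G = 2⁰ ϖ ι L♭`; conjunct 2 of the crux gives `μ(G) = 0`,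
i.e. `2 ∤ L♭` (`not_two_dvd_iff_mu_eq_of_isPollackPair_two_of_periodUnit`, lead g0 p567665; the cyclotomic
variable binder is inhabited by `exists_isCyclotomic_isTopGenerator_isCyclotomicVariable_holds`). This is g0's
`flatMuZero_of_signedMuAnalyticAtTwoPlus_of_periodUnit` run on the crux. [cite: Pollack2003, Prop. 6.18]
[cite: GreenbergVatsal2000, §3, Remark 3.4] -/
theorem flatMuZero_of_crux_of_periodUnit (h : SignedMuVanishingAtTwoPlus)
    (hper : ∀ (W : WeierstrassCurve ℚ) [W.IsElliptic] [W.IsGloballyMinimal], GoodSS W 2 →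
      ∀ [NeZero (W.conductorNorm ℤ)] (f : CuspForm (Gamma0 (W.conductorNorm ℤ)) 2), IsNewformOf W f →
      ∃ u : ℚ, ‖(u : ℚ_[2])‖ = 1 ∧ W.realPeriodRat = u * plusPeriod f) :
    ∀ (W : WeierstrassCurve ℚ) [W.IsElliptic] [W.IsGloballyMinimal], ¬ W.HasCM →
      W.analyticRank = 0 → GoodSS W 2 → W.frobeniusTrace 2 = 0 → W.Δ < 0 →
      ∀ [NeZero (W.conductorNorm ℤ)] (f : CuspForm (Gamma0 (W.conductorNorm ℤ)) 2), IsNewformOf W f →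
      ∀ (Lplus Lminus : IwasawaAlgebra 2), IsPollackPair f 2 Lplus Lminus →
      ¬ PowerSeries.C (2 : ℤ_[2]) ∣ Lminus := by
  intro W _ _ hCM hr hss ha hΔ _ f hf Lplus Lminus hP
  obtain ⟨κ, -, γ, -, hγ'⟩ := exists_isCyclotomic_isTopGenerator_isCyclotomicVariable_holds 2
  obtain ⟨u, hu1, hΩ⟩ := hper W hss f hf
  have hu0 : u ≠ 0 := by rintro rfl; simp at hu1
  have hu0' : (u : ℝ) ≠ 0 := by exact_mod_cast hu0
  -- the period ratio `ϖ = u⁻¹`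
  have hϖ : ((u⁻¹ : ℚ) : ℝ) * W.realPeriodRat = plusPeriod f := by
    rw [hΩ, Rat.cast_inv, ← mul_assoc, inv_mul_cancel₀ hu0', one_mul]
  have hϖ1 : ‖((u⁻¹ : ℚ) : ℚ_[2])‖ = 1 := by rw [Rat.cast_inv, norm_inv, hu1, inv_one]
  obtain ⟨w, hw⟩ := exists_units_coe_eq_of_norm_ratCast_eq_one (p := 2) hϖ1
  -- `G = C(w) · L♭`, `m = 0`
  have hk : kobayashiL (p := 2) 1 Lplus Lminus = Lminus := by unfold kobayashiL; rw [if_pos rfl]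
  have hG : iwasawaToPowerSeries 2 (PowerSeries.C (w : ℤ_[2]) * Lminus) =
      PowerSeries.C ((2 : ℚ_[2]) ^ 0 * ((u⁻¹ : ℚ) : ℚ_[2])) *
        iwasawaToPowerSeries 2 (kobayashiL 1 Lplus Lminus) := by
    rw [hk, map_mul, pow_zero, one_mul, ← hw]
    congr 1
    simp [iwasawaToPowerSeries]
  have hμ := (h W hCM hr hss ha hΔ).2 γ hγ' f hf (u⁻¹) hϖ Lplus Lminus hP _ 0 hG
  exact (not_two_dvd_iff_mu_eq_of_isPollackPair_two_of_periodUnit hϖ ⟨u, hu1, hΩ⟩ hP _ 0 hG).mpr hμ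

/-- **What the v4 cut costs — nothing on three of four stubs.** GRANTED PER, the crux `SignedMuVanishingAtTwoPlus` is
EQUIVALENT to the conjunction of its algebraic half (conjunct 1 verbatim) and FLAT (`2 ∤ L♭_f` for every Pollack pair
at 2 on the habitat⁺): ⇒ by `flatMuZero_of_crux_of_periodUnit`, ⇐ by
`mu_eq_of_isPollackPair_two_of_periodUnit_of_not_two_dvd`. (The seed child is implied by the crux outright —
w2's `signedMuSeedAtTwoPlus_of_signedMuVanishingAtTwoPlus`; only the propagation stub says more than the crux.)
[cite: Pollack2003, Prop. 6.18] [cite: GreenbergVatsal2000, §3, Remark 3.4] -/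
theorem signedMuVanishingAtTwoPlus_iff_muAlgebraic_and_flatMuZero_of_periodUnit
    (hper : ∀ (W : WeierstrassCurve ℚ) [W.IsElliptic] [W.IsGloballyMinimal], GoodSS W 2 →
      ∀ [NeZero (W.conductorNorm ℤ)] (f : CuspForm (Gamma0 (W.conductorNorm ℤ)) 2), IsNewformOf W f →
      ∃ u : ℚ, ‖(u : ℚ_[2])‖ = 1 ∧ W.realPeriodRat = u * plusPeriod f) :
    SignedMuVanishingAtTwoPlus ↔
      ((∀ (W : WeierstrassCurve ℚ) [W.IsElliptic] [W.IsGloballyMinimal], ¬ W.HasCM → W.analyticRank = 0 →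
        GoodSS W 2 → W.frobeniusTrace 2 = 0 → W.Δ < 0 →
        ∀ (κ : ZpExtension ℚ 2) (γ : Field.absoluteGaloisGroup ℚ), κ.IsCyclotomic → κ.IsTopGenerator γ →
        ∀ (D : SignedSelmerDualData W κ γ 1) [Module.Finite (IwasawaAlgebra 2) D.X],
          Module.IsTorsion (IwasawaAlgebra 2) D.X ∧ D.mu = 0) ∧
      (∀ (W : WeierstrassCurve ℚ) [W.IsElliptic] [W.IsGloballyMinimal], ¬ W.HasCM →
        W.analyticRank = 0 → GoodSS W 2 → W.frobeniusTrace 2 = 0 → W.Δ < 0 →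
        ∀ [NeZero (W.conductorNorm ℤ)] (f : CuspForm (Gamma0 (W.conductorNorm ℤ)) 2), IsNewformOf W f →
        ∀ (Lplus Lminus : IwasawaAlgebra 2), IsPollackPair f 2 Lplus Lminus →
        ¬ PowerSeries.C (2 : ℤ_[2]) ∣ Lminus)) := by
  constructor
  · intro h
    refine ⟨fun W _ _ hCM hr hss ha hΔ ↦ (h W hCM hr hss ha hΔ).1, ?_⟩
    exact flatMuZero_of_crux_of_periodUnit h hper
  · rintro ⟨halg, hflat⟩ W _ _ hCM hr hss ha hΔ
    refine ⟨halg W hCM hr hss ha hΔ, ?_⟩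
    intro γ _ _ f hf ϖ hϖ Lplus Lminus hP G m hG
    exact mu_eq_of_isPollackPair_two_of_periodUnit_of_not_two_dvd hϖ (hper W hss f hf)
      (hflat W hCM hr hss ha hΔ f hf Lplus Lminus hP) G m hG

/-- The same equivalence GRANTED the print fact Abbes–Ullmo Thm A in place of PER.
[cite: AbbesUllmo1996, Thm. A] [cite: Pollack2003, Prop. 6.18] -/
theorem signedMuVanishingAtTwoPlus_iff_muAlgebraic_and_flatMuZero_of_abbesUllmo
    (hAU : abbesUllmo_not_dvd_maninConstant_of_not_dvd_level) :
    SignedMuVanishingAtTwoPlus ↔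
      ((∀ (W : WeierstrassCurve ℚ) [W.IsElliptic] [W.IsGloballyMinimal], ¬ W.HasCM → W.analyticRank = 0 →
        GoodSS W 2 → W.frobeniusTrace 2 = 0 → W.Δ < 0 →
        ∀ (κ : ZpExtension ℚ 2) (γ : Field.absoluteGaloisGroup ℚ), κ.IsCyclotomic → κ.IsTopGenerator γ →
        ∀ (D : SignedSelmerDualData W κ γ 1) [Module.Finite (IwasawaAlgebra 2) D.X],
          Module.IsTorsion (IwasawaAlgebra 2) D.X ∧ D.mu = 0) ∧
      (∀ (W : WeierstrassCurve ℚ) [W.IsElliptic] [W.IsGloballyMinimal], ¬ W.HasCM →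
        W.analyticRank = 0 → GoodSS W 2 → W.frobeniusTrace 2 = 0 → W.Δ < 0 →
        ∀ [NeZero (W.conductorNorm ℤ)] (f : CuspForm (Gamma0 (W.conductorNorm ℤ)) 2), IsNewformOf W f →
        ∀ (Lplus Lminus : IwasawaAlgebra 2), IsPollackPair f 2 Lplus Lminus →
        ¬ PowerSeries.C (2 : ℤ_[2]) ∣ Lminus)) :=
  signedMuVanishingAtTwoPlus_iff_muAlgebraic_and_flatMuZero_of_periodUnit
    (fun _ _ _ hss _ _ hf ↦ exists_periodUnit_two_of_abbesUllmo hAU hss hf)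

/-! ## §3. Cross-route: the seed at a curve with a rational CM partner, from ThetaPartnerAtTwo's K2 -/

/-- **The seed conclusion at `W` from a rational CM partner and route ThetaPartnerAtTwo's K2 (item 20307) BY NAME.**
If `A/ℚ` is a CM curve, good supersingular at `2` with `a₂(A) = 0`, and `W[2] ≃ A[2]` G_ℚ-equivariantly, then
`SignedMainConjectureCMTwo` (Pollack–Rubin Thm 7.3 read at `p = 2`: `X⁺(A/ℚ_∞)` torsion with `μ⁺ = 0` for every
signed dual datum) supplies exactly the partner the seed child 21438 asks for at `W` — the two routes' μ-seeds are one
statement on the rational theta habitat. [cite: PollackRubin2004, Thm. 7.3] [cite: GreenbergVatsal2000, Prop. (2.8)] -/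
theorem seedAt_of_cmPartner_of_signedMainConjectureCMTwo
    (hK2 : Theses.ThetaPartnerAtTwo.SignedMainConjectureCMTwo)
    {W : WeierstrassCurve ℚ} [W.IsElliptic] [W.IsGloballyMinimal]
    {A : WeierstrassCurve ℚ} [hA : A.IsElliptic] [hA' : A.IsGloballyMinimal] (hCM : A.HasCM) (hssA : GoodSS A 2)
    (haA : A.frobeniusTrace 2 = 0)
    (hiso : ∃ e : WeierstrassCurve.geomTorsion W (2 : ℤ) ≃+ WeierstrassCurve.geomTorsion A (2 : ℤ),
      ∀ (σ : Field.absoluteGaloisGroup ℚ) (P : WeierstrassCurve.geomTorsion W (2 : ℤ)), e (σ • P) = σ • e P) :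
    ∃ (A : WeierstrassCurve ℚ) (_ : A.IsElliptic) (_ : A.IsGloballyMinimal), GoodSS A 2 ∧ A.frobeniusTrace 2 = 0 ∧
      (∃ e : WeierstrassCurve.geomTorsion W (2 : ℤ) ≃+ WeierstrassCurve.geomTorsion A (2 : ℤ),
        ∀ (σ : Field.absoluteGaloisGroup ℚ) (P : WeierstrassCurve.geomTorsion W (2 : ℤ)), e (σ • P) = σ • e P) ∧
      (∀ (κ : ZpExtension ℚ 2) (γ : Field.absoluteGaloisGroup ℚ), κ.IsCyclotomic → κ.IsTopGenerator γ →
        ∀ (D : SignedSelmerDualData A κ γ 1) [Module.Finite (IwasawaAlgebra 2) D.X],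
          Module.IsTorsion (IwasawaAlgebra 2) D.X ∧ D.mu = 0) :=
  ⟨A, hA, hA', hssA, haA, hiso, fun κ γ hκ hγ D _ ↦ (hK2 A hCM hssA haA).1 κ γ hκ hγ D⟩

/-- The same from the RANK-0 form K2 `SignedMainConjectureCMTwoRankZero` (item 20312, the instance ThetaPartnerAtTwo's
`closes` consumes) when the CM partner has analytic rank `0`. [cite: PollackRubin2004, Thm. 7.3] -/
theorem seedAt_of_cmPartner_of_signedMainConjectureCMTwoRankZero
    (hK2 : Theses.ThetaPartnerAtTwo.SignedMainConjectureCMTwoRankZero)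
    {W : WeierstrassCurve ℚ} [W.IsElliptic] [W.IsGloballyMinimal]
    {A : WeierstrassCurve ℚ} [hA : A.IsElliptic] [hA' : A.IsGloballyMinimal] (hCM : A.HasCM) (hrA : A.analyticRank = 0)
    (hssA : GoodSS A 2) (haA : A.frobeniusTrace 2 = 0)
    (hiso : ∃ e : WeierstrassCurve.geomTorsion W (2 : ℤ) ≃+ WeierstrassCurve.geomTorsion A (2 : ℤ),
      ∀ (σ : Field.absoluteGaloisGroup ℚ) (P : WeierstrassCurve.geomTorsion W (2 : ℤ)), e (σ • P) = σ • e P) :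
    ∃ (A : WeierstrassCurve ℚ) (_ : A.IsElliptic) (_ : A.IsGloballyMinimal), GoodSS A 2 ∧ A.frobeniusTrace 2 = 0 ∧
      (∃ e : WeierstrassCurve.geomTorsion W (2 : ℤ) ≃+ WeierstrassCurve.geomTorsion A (2 : ℤ),
        ∀ (σ : Field.absoluteGaloisGroup ℚ) (P : WeierstrassCurve.geomTorsion W (2 : ℤ)), e (σ • P) = σ • e P) ∧
      (∀ (κ : ZpExtension ℚ 2) (γ : Field.absoluteGaloisGroup ℚ), κ.IsCyclotomic → κ.IsTopGenerator γ →
        ∀ (D : SignedSelmerDualData A κ γ 1) [Module.Finite (IwasawaAlgebra 2) D.X],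
          Module.IsTorsion (IwasawaAlgebra 2) D.X ∧ D.mu = 0) :=
  ⟨A, hA, hA', hssA, haA, hiso, fun κ γ hκ hγ D _ ↦ (hK2 A hCM hrA hssA haA).1 κ γ hκ hγ D⟩

/-- **Hence, on a sub-habitat where every class has a rational CM partner, the seed child 21438 IS K2**: if every
habitat⁺ curve admits a CM partner `A` as above, `SignedMainConjectureCMTwo` implies `SignedMuSeedAtTwoPlus`. (On the
full 153-class habitat⁺ only 19 classes have a rational CM partner — the hypothesis `hpartner` is the sub-habitat
restriction, stated as an implication so that nothing is asserted.) [cite: PollackRubin2004, Thm. 7.3]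
[cite: GreenbergVatsal2000, Prop. (2.8)] -/
theorem signedMuSeedAtTwoPlus_of_cmPartners_of_signedMainConjectureCMTwo
    (hK2 : Theses.ThetaPartnerAtTwo.SignedMainConjectureCMTwo)
    (hpartner : ∀ (W : WeierstrassCurve ℚ) [W.IsElliptic] [W.IsGloballyMinimal], ¬ W.HasCM → W.analyticRank = 0 →
      GoodSS W 2 → W.frobeniusTrace 2 = 0 → W.Δ < 0 →
      ∃ (A : WeierstrassCurve ℚ) (_ : A.IsElliptic) (_ : A.IsGloballyMinimal), A.HasCM ∧ GoodSS A 2 ∧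
        A.frobeniusTrace 2 = 0 ∧
        ∃ e : WeierstrassCurve.geomTorsion W (2 : ℤ) ≃+ WeierstrassCurve.geomTorsion A (2 : ℤ),
          ∀ (σ : Field.absoluteGaloisGroup ℚ) (P : WeierstrassCurve.geomTorsion W (2 : ℤ)), e (σ • P) = σ • e P) :
    SignedMuSeedAtTwoPlus := by
  intro W _ _ hCM hr hss ha hΔ
  obtain ⟨A, hA, hA', hCMA, hssA, haA, hiso⟩ := hpartner W hCM hr hss ha hΔ
  exact seedAt_of_cmPartner_of_signedMainConjectureCMTwo hK2 hCMA hssA haA hiso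

end Summit.BirchSwinnertonDyer.BirchSwinnertonDyer.Theorems.SignedMuAtTwo

end
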